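import Literature.Topology.FourManifolds.MilnorLocalIsotopyProof
import HarnessLib

/-!
# Milnor 1965, Theorem 5.6 in the form of two compactly supported ambient isotopies, for a germ

Topic `Literature/Topology/FourManifolds`; sequel of `MilnorLocalIsotopyProof.lean`
(`Literature.Topology.FourManifolds.Milnor1965_localIsotopy_holds`, Milnor's Theorem 5.6).  For
the application of Thm. 5.6 in the proof of Thm. 5.4, Assertion 6 (Milnor, *Lectures on the
h-cobordism theorem* (1965), PDF pp. 31–32) the map `h₀⁻¹h` is only a germ at `p₁` (smooth on an
open neighbourhood of `0` in the level coordinates), and what is transported to the level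
`f⁻¹(b₂)` are the two compactly supported ambient isotopies of `Rⁿ = Rᵃ × Rᵇ` from which the
isotopy `h'_t = Ψ_t ∘ h ∘ Φ_t` of `MilnorLocalIsotopyProof.lean` is built, rather than `h'_t`
itself.  This file records that form:

* `exists_ambientIsotopy_localInverse_of_contDiffOn` — the source isotopy `Φ` of
  `Literature.Topology.FourManifolds.exists_ambientIsotopy_localInverse` for a map `φ` that is
  only smooth on an open neighbourhood `O` of `0` (same proof; the local inverse at `0` and the
  set where it is smooth are cut down to `O`);
* `exists_ambientIsotopy_pair` — **Thm. 5.6 for a germ, as a pair of ambient isotopies**: for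
  `φ` smooth on an open `O ∋ 0` with `φ 0 = 0`, `det Dφ(0) > 0` and `det A > 0` for the block
  `A` of `Dφ(0)` (Milnor's hypotheses: orientation-preserving, `φ(Rᵃ)` transverse to `Rᵇ` at
  `0` with intersection number `+1`), and any `ρ > 0`, there are ambient isotopies `Ψ` (moving
  points parallel to `Rᵇ`) and `Φ` (mapping `Rᵃ × 0` into itself) of `Rᵃ × Rᵇ`, both supported
  in `B(0, ρ)` and fixing `0`, with `Ψ₁ ∘ φ ∘ Φ₁ = id` near `0`.  Conditions (I), (II) of
  Thm. 5.6 for `Ψ_t ∘ φ ∘ Φ_t` are then immediate, and (III) follows wherever hypothesis 2) of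
  Thm. 5.6 is available for `φ` (`fst_eq_zero_iff_of_pair`).

## References

* J. Milnor, *Lectures on the h-cobordism theorem*, notes by L. Siebenmann and J. Sondow,
  Princeton Mathematical Notes (1965): Thm. 5.6 (PDF p. 32); proof of Thm. 5.4, Assertion 6
  (PDF pp. 31–32).  Held: `lit read book:milnornd-lectures-h-cobordism-theorem`.
  [MilnorHCobordism1965]
* M. W. Hirsch, *Differential Topology*, GTM 33 (1976), Ch. 8 §3, proof of Thm. 3.1.
  [HirschDT1976]
-/

open scoped Manifold ContDiff Topology
open Set Function Filter Metric

noncomputable section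

namespace Literature.Topology.FourManifolds

section SourceInverse

variable {a b : ℕ}

/-- **The source isotopy of `exists_ambientIsotopy_localInverse` for a germ**: as there, for
`φ` smooth on an open neighbourhood `O` of `0` only. [cite: HirschDT1976, Ch. 8 §3, proof of Thm. 3.1] -/
theorem exists_ambientIsotopy_localInverse_of_contDiffOn
    {φ : EuclideanSpace ℝ (Fin a) × EuclideanSpace ℝ (Fin b) → EuclideanSpace ℝ (Fin a) × EuclideanSpace ℝ (Fin b)}
    {O : Set (EuclideanSpace ℝ (Fin a) × EuclideanSpace ℝ (Fin b))} (hO : IsOpen O) (h0O : (0 : EuclideanSpace ℝ (Fin a) × EuclideanSpace ℝ (Fin b)) ∈ O)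
    (hs : ContDiffOn ℝ ∞ φ O)
    (h0 : φ 0 = 0) (hdet : 0 < (fderiv ℝ φ 0).det) (hA : 0 < (fstBlock (fderiv ℝ φ 0)).det)
    (hSa : ∀ᶠ u in 𝓝 (0 : EuclideanSpace ℝ (Fin a)), (φ (u, 0)).2 = 0)
    {σ : EuclideanSpace ℝ (Fin a) → EuclideanSpace ℝ (Fin a)} (hσ : Tendsto σ (𝓝 0) (𝓝 0))
    (hσ' : ∀ᶠ w in 𝓝 (0 : EuclideanSpace ℝ (Fin a)), φ (σ w, 0) = (w, 0)) {ρ : ℝ} (hρ : 0 < ρ) :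
    ∃ Φ : AmbientIsotopy 𝓘(ℝ, EuclideanSpace ℝ (Fin a) × EuclideanSpace ℝ (Fin b))
      (EuclideanSpace ℝ (Fin a) × EuclideanSpace ℝ (Fin b)),
      (∀ t x, ρ ≤ ‖x‖ → Φ.toFun t x = x) ∧ (∀ t, Φ.toFun t 0 = 0) ∧
      (∀ t x, x.2 = 0 → (Φ.toFun t x).2 = 0) ∧
      ∀ᶠ x in 𝓝 (0 : (EuclideanSpace ℝ (Fin a) × EuclideanSpace ℝ (Fin b))), φ (Φ.toFun 1 x) = x := by
  obtain ⟨ε₀, hε₀, H⟩ :=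
    exists_ambientIsotopy_realising_germ (EuclideanSpace ℝ (Fin a) × EuclideanSpace ℝ (Fin b))
  set Sa : Submodule ℝ (EuclideanSpace ℝ (Fin a) × EuclideanSpace ℝ (Fin b)) :=
    (⊤ : Submodule ℝ (EuclideanSpace ℝ (Fin a))).prod ⊥ with hSa'
  have hmemSa : ∀ y : EuclideanSpace ℝ (Fin a) × EuclideanSpace ℝ (Fin b), y ∈ Sa ↔ y.2 = 0 :=
    fun y => mem_fstPlane_iff
  -- the derivative at `0` as an automorphism
  set L := fderiv ℝ φ 0 with hL
  have hsat : ContDiffAt ℝ ∞ φ 0 := hs.contDiffAt (hO.mem_nhds h0O)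
  have hLd : HasFDerivAt φ L 0 := (hsat.differentiableAt (by simp)).hasFDerivAt
  set Le : (EuclideanSpace ℝ (Fin a) × EuclideanSpace ℝ (Fin b)) ≃L[ℝ] (EuclideanSpace ℝ (Fin a) × EuclideanSpace ℝ (Fin b)) :=
    L.toContinuousLinearEquivOfDetNeZero hdet.ne'
    with hLe
  have hLeL : (Le : _ →L[ℝ] _) = L :=
    ContinuousLinearMap.coe_toContinuousLinearEquivOfDetNeZero _ _
  have hLex : ∀ x, Le x = L x := fun x => by rw [← hLeL]; rfl
  have hstrict : HasStrictFDerivAt φ (Le : _ →L[ℝ] _) 0 := by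
    rw [hLeL]
    exact hsat.hasStrictFDerivAt' hLd (by simp)
  -- `L` maps `Rᵃ × 0` into itself (differentiate `(φ (u, 0)).2 = 0`)
  have hLS : ∀ u : EuclideanSpace ℝ (Fin a), (L (u, 0)).2 = 0 := by
    have h1 : HasFDerivAt (fun u : EuclideanSpace ℝ (Fin a) => (φ (u, 0)).2)
        ((ContinuousLinearMap.snd ℝ (EuclideanSpace ℝ (Fin a)) (EuclideanSpace ℝ (Fin b))).comp
          (L.comp (ContinuousLinearMap.inl ℝ (EuclideanSpace ℝ (Fin a)) (EuclideanSpace ℝ (Fin b))))) 0 := by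
      have hi : HasFDerivAt
          (fun u : EuclideanSpace ℝ (Fin a) => ((u, (0 : EuclideanSpace ℝ (Fin b))) : EuclideanSpace ℝ (Fin a) × EuclideanSpace ℝ (Fin b)))
          (ContinuousLinearMap.inl ℝ (EuclideanSpace ℝ (Fin a)) (EuclideanSpace ℝ (Fin b))) 0 :=
        (hasFDerivAt_id (0 : EuclideanSpace ℝ (Fin a))).prodMk
          (hasFDerivAt_const (0 : EuclideanSpace ℝ (Fin b)) (0 : EuclideanSpace ℝ (Fin a)))
      have hφ : HasFDerivAt φ L
          ((fun u : EuclideanSpace ℝ (Fin a) => ((u, (0 : EuclideanSpace ℝ (Fin b))) : EuclideanSpace ℝ (Fin a) × EuclideanSpace ℝ (Fin b))) 0) :=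
        hLd
      exact hasFDerivAt_snd.comp (0 : EuclideanSpace ℝ (Fin a)) (hφ.comp (0 : EuclideanSpace ℝ (Fin a)) hi)
    have h2 : HasFDerivAt (fun u : EuclideanSpace ℝ (Fin a) => (φ (u, 0)).2)
        (0 : EuclideanSpace ℝ (Fin a) →L[ℝ] EuclideanSpace ℝ (Fin b)) 0 :=
      (hasFDerivAt_const (0 : EuclideanSpace ℝ (Fin b)) (0 : EuclideanSpace ℝ (Fin a))).congr_of_eventuallyEq
        (hSa.mono fun u hu => hu)
    have h3 := h1.unique h2
    intro u
    have := congrArg (fun T : EuclideanSpace ℝ (Fin a) →L[ℝ] EuclideanSpace ℝ (Fin b) => T u) h3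
    simpa using this
  have hLeS : ∀ u : EuclideanSpace ℝ (Fin a), (Le (u, 0)).2 = 0 := fun u => by rw [hLex]; exact hLS u
  -- the block `A` and the inverse
  set A : EuclideanSpace ℝ (Fin a) →L[ℝ] EuclideanSpace ℝ (Fin a) := fstBlock L with hAdef
  set Ae : EuclideanSpace ℝ (Fin a) ≃L[ℝ] EuclideanSpace ℝ (Fin a) :=
    A.toContinuousLinearEquivOfDetNeZero hA.ne' with hAe
  have hAeA : (Ae : EuclideanSpace ℝ (Fin a) →L[ℝ] EuclideanSpace ℝ (Fin a)) = A :=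
    ContinuousLinearMap.coe_toContinuousLinearEquivOfDetNeZero _ _
  have hAex : ∀ u, Ae u = A u := fun u => by rw [← hAeA]; rfl
  have hLeu : ∀ u : EuclideanSpace ℝ (Fin a), Le (u, 0) = (A u, 0) := by
    intro u
    refine Prod.ext ?_ (hLeS u)
    rw [hLex]
    rfl
  have hLesymm : ∀ w : EuclideanSpace ℝ (Fin a), Le.symm (w, 0) = (Ae.symm w, 0) := by
    intro w
    apply Le.injective
    rw [ContinuousLinearEquiv.apply_symm_apply, hLeu, ← hAex, ContinuousLinearEquiv.apply_symm_apply]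
  have hLsymmS : ∀ u : EuclideanSpace ℝ (Fin a), (Le.symm (u, 0)).2 = 0 := fun u => by rw [hLesymm]
  have hdet' : 0 < ((Le.symm : _ ≃L[ℝ] _) :
      (EuclideanSpace ℝ (Fin a) × EuclideanSpace ℝ (Fin b)) →L[ℝ] (EuclideanSpace ℝ (Fin a) × EuclideanSpace ℝ (Fin b))).det := by
    rw [ContinuousLinearEquiv.det_coe_symm, hLeL]
    exact inv_pos.2 hdet
  have hA' : 0 < LinearMap.det ((ContinuousLinearMap.fst ℝ (EuclideanSpace ℝ (Fin a)) (EuclideanSpace ℝ (Fin b))).comp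
      (((Le.symm : _ ≃L[ℝ] _) : _ →L[ℝ] _).comp
        (ContinuousLinearMap.inl ℝ (EuclideanSpace ℝ (Fin a)) (EuclideanSpace ℝ (Fin b)))) : EuclideanSpace ℝ (Fin a) →ₗ[ℝ] EuclideanSpace ℝ (Fin a)) := by
    have heq : (ContinuousLinearMap.fst ℝ (EuclideanSpace ℝ (Fin a)) (EuclideanSpace ℝ (Fin b))).comp
        (((Le.symm : _ ≃L[ℝ] _) : _ →L[ℝ] _).comp
          (ContinuousLinearMap.inl ℝ (EuclideanSpace ℝ (Fin a)) (EuclideanSpace ℝ (Fin b)))) = (Ae.symm : EuclideanSpace ℝ (Fin a) →L[ℝ] EuclideanSpace ℝ (Fin a)) := by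
      ext1 w
      change (Le.symm (w, 0)).1 = Ae.symm w
      rw [hLesymm]
    rw [heq]
    change 0 < ((Ae.symm : EuclideanSpace ℝ (Fin a) ≃L[ℝ] EuclideanSpace ℝ (Fin a)) :
      EuclideanSpace ℝ (Fin a) →L[ℝ] EuclideanSpace ℝ (Fin a)).det
    rw [ContinuousLinearEquiv.det_coe_symm, hAeA]
    exact inv_pos.2 hA
  obtain ⟨Ms, hMnorm, hMS, hMprod⟩ :=
    exists_list_prod_eq_of_snd_apply_inl_eq_zero Le.symm hLsymmS hdet' hA' hε₀.1
  -- the local inverse `Θ` and an open set on which it is smooth and preserves `Rᵃ × 0`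
  set Hφ := hstrict.toOpenPartialHomeomorph φ with hHφ
  set Θ : EuclideanSpace ℝ (Fin a) × EuclideanSpace ℝ (Fin b) → EuclideanSpace ℝ (Fin a) × EuclideanSpace ℝ (Fin b) :=
    hstrict.localInverse φ _ 0 with hΘdef
  have hΘH : Θ = Hφ.symm := rfl
  have hleft : ∀ᶠ x in 𝓝 (0 : EuclideanSpace ℝ (Fin a) × EuclideanSpace ℝ (Fin b)), Θ (φ x) = x :=
    hstrict.eventually_left_inverse
  have hright : ∀ᶠ y in 𝓝 (0 : (EuclideanSpace ℝ (Fin a) × EuclideanSpace ℝ (Fin b))), φ (Θ y) = y := by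
    have := hstrict.eventually_right_inverse
    rwa [h0] at this
  have hΘ0 : Θ 0 = 0 := by
    have := hstrict.localInverse_apply_image
    rwa [h0] at this
  have hDΘ : HasFDerivAt Θ ((Ms.prod : _ ≃L[ℝ] _) : _ →L[ℝ] _) 0 := by
    rw [hMprod]
    have := hstrict.to_localInverse
    rw [h0] at this
    exact this.hasFDerivAt
  have hΘt : Tendsto Θ (𝓝 0) (𝓝 0) := by
    have := hstrict.localInverse_tendsto
    rwa [h0] at this
  -- `Θ (w, 0) = (σ w, 0)` for `w` near `0`
  have hΘσ : ∀ᶠ w in 𝓝 (0 : EuclideanSpace ℝ (Fin a)), Θ (w, 0) = (σ w, 0) := by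
    have h1 : Tendsto (fun w => ((σ w, (0 : EuclideanSpace ℝ (Fin b))) : EuclideanSpace ℝ (Fin a) × EuclideanSpace ℝ (Fin b)))
        (𝓝 0) (𝓝 0) := by
      have : ((0 : EuclideanSpace ℝ (Fin a)), (0 : EuclideanSpace ℝ (Fin b))) =
          (0 : EuclideanSpace ℝ (Fin a) × EuclideanSpace ℝ (Fin b)) := rfl
      rw [← this, nhds_prod_eq]
      exact hσ.prodMk tendsto_const_nhds
    filter_upwards [hσ', h1.eventually hleft] with w hw hl
    rw [← hw]
    exact hl
  obtain ⟨δ, hδ, hδΘ⟩ := Metric.eventually_nhds_iff_ball.1 hΘσ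
  -- the open set
  set U : Set (EuclideanSpace ℝ (Fin a) × EuclideanSpace ℝ (Fin b)) :=
    {x ∈ O | (fderiv ℝ φ x).det ≠ 0} with hU
  have hUo : IsOpen U := isOpen_det_fderiv_ne_zero hO hs (by simp)
  set O : Set (EuclideanSpace ℝ (Fin a) × EuclideanSpace ℝ (Fin b)) :=
    (Hφ.target ∩ Hφ.symm ⁻¹' U) ∩ Prod.fst ⁻¹' ball (0 : EuclideanSpace ℝ (Fin a)) δ with hO
  have hOo : IsOpen O :=
    (Hφ.isOpen_inter_preimage_symm hUo).inter (isOpen_ball.preimage continuous_fst)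
  have h0t : (0 : (EuclideanSpace ℝ (Fin a) × EuclideanSpace ℝ (Fin b))) ∈ Hφ.target := by
    have := hstrict.image_mem_toOpenPartialHomeomorph_target
    rwa [h0] at this
  have h0O : (0 : (EuclideanSpace ℝ (Fin a) × EuclideanSpace ℝ (Fin b))) ∈ O := by
    refine ⟨⟨h0t, ?_⟩, ?_⟩
    · rw [mem_preimage]
      change Θ 0 ∈ U
      rw [hΘ0]
      exact ⟨h0O, hdet.ne'⟩
    · simpa using hδ
  have hΘs : ContDiffOn ℝ ∞ Θ O := by
    rw [hΘH]
    refine (OpenPartialHomeomorph.contDiffOn_symm_of_det_fderiv_ne_zero Hφ hUo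
      (hs.mono fun x hx => hx.1) (fun x hx => hx.2) (by simp)).mono ?_
    exact inter_subset_left
  have hΘS : ∀ y ∈ O, y ∈ Sa → Θ y ∈ Sa := by
    intro y hy hyS
    rw [hmemSa] at hyS ⊢
    have hy1 : y.1 ∈ ball (0 : EuclideanSpace ℝ (Fin a)) δ := hy.2
    have : y = (y.1, 0) := Prod.ext rfl hyS
    rw [this, hδΘ y.1 hy1]
  obtain ⟨Φ, hsupp, h1, hS, -, hfix⟩ :=
    H (Sa) ⊤ Θ O Ms ρ hOo h0O hΘs hΘ0 hΘS (fun y _ => Submodule.mem_top) hMnorm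
      (fun M hM y hy => by
        rw [hmemSa] at hy ⊢
        have : y = (y.1, 0) := Prod.ext rfl hy
        rw [this]
        exact hMS M hM y.1)
      (fun M _ y => Submodule.mem_top) hDΘ hρ
  refine ⟨Φ, hsupp, hfix, fun t x hx => ?_, ?_⟩
  · have := hS t x ((hmemSa _).2 hx)
    exact (hmemSa _).1 this
  · filter_upwards [h1, hright] with x hx hr
    rw [hx, hr]


end SourceInverse

section Pair

variable {a b : ℕ}

/-- **Milnor 1965, Thm. 5.6 for a germ, as a pair of compactly supported ambient isotopies.**
Let `φ : Rᵃ × Rᵇ → Rᵃ × Rᵇ` be smooth on an open `O ∋ 0` with `φ 0 = 0`, `det Dφ(0) > 0` and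
`det A > 0` for the block `A = fstBlock (Dφ 0)`.  Then for every `ρ > 0` there are ambient
isotopies `Ψ`, `Φ` of `Rᵃ × Rᵇ`, all of whose stages are the identity off `B(0, ρ)` and fix `0`,
those of `Ψ` preserving the first coordinate and those of `Φ` mapping `Rᵃ × 0` into itself, such
that `Ψ₁ (φ (Φ₁ x)) = x` for `x` near `0` (so `h'_t = Ψ_t ∘ φ ∘ Φ_t` deforms `φ` to the identity
near `0` through maps agreeing with `φ` at `0` and off `B(0, ρ) ∪ φ⁻¹(B(0, ρ))`).  Proof as for
`Literature.Topology.FourManifolds.Milnor1965_localIsotopy_holds`: `Ψ` straightens the graph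
`φ(Rᵃ)` (`exists_ambientIsotopy_straighten`), `Φ` realises the local inverse of `Ψ₁ ∘ φ`
(`exists_ambientIsotopy_localInverse_of_contDiffOn`).
[cite: MilnorHCobordism1965, Thm. 5.6 (PDF p. 32)] [cite: HirschDT1976, Ch. 8 §3, proof of Thm. 3.1] -/
theorem exists_ambientIsotopy_pair
    {φ : EuclideanSpace ℝ (Fin a) × EuclideanSpace ℝ (Fin b) → EuclideanSpace ℝ (Fin a) × EuclideanSpace ℝ (Fin b)}
    {O : Set (EuclideanSpace ℝ (Fin a) × EuclideanSpace ℝ (Fin b))} (hO : IsOpen O) (h0O : (0 : EuclideanSpace ℝ (Fin a) × EuclideanSpace ℝ (Fin b)) ∈ O)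
    (hs : ContDiffOn ℝ ∞ φ O) (h0 : φ 0 = 0) (hdet : 0 < (fderiv ℝ φ 0).det)
    (hA : 0 < (fstBlock (fderiv ℝ φ 0)).det) {ρ : ℝ} (hρ : 0 < ρ) :
    ∃ Ψ Φ : AmbientIsotopy 𝓘(ℝ, EuclideanSpace ℝ (Fin a) × EuclideanSpace ℝ (Fin b)) (EuclideanSpace ℝ (Fin a) × EuclideanSpace ℝ (Fin b)),
      (∀ t y, ρ ≤ ‖y‖ → Ψ.toFun t y = y) ∧ (∀ t, Ψ.toFun t 0 = 0) ∧
      (∀ t y, (Ψ.toFun t y).1 = y.1) ∧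
      (∀ t x, ρ ≤ ‖x‖ → Φ.toFun t x = x) ∧ (∀ t, Φ.toFun t 0 = 0) ∧
      (∀ t x, x.2 = 0 → (Φ.toFun t x).2 = 0) ∧
      ∀ᶠ x in 𝓝 (0 : EuclideanSpace ℝ (Fin a) × EuclideanSpace ℝ (Fin b)), Ψ.toFun 1 (φ (Φ.toFun 1 x)) = x := by
  have hsat : ContDiffAt ℝ ∞ φ 0 := hs.contDiffAt (hO.mem_nhds h0O)
  set L := fderiv ℝ φ 0 with hL
  have hLd : HasFDerivAt φ L 0 := (hsat.differentiableAt (by simp)).hasFDerivAt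
  -- `φ(Rᵃ)` is a graph near `0`
  set Ae : EuclideanSpace ℝ (Fin a) ≃L[ℝ] EuclideanSpace ℝ (Fin a) :=
    (fstBlock L).toContinuousLinearEquivOfDetNeZero hA.ne' with hAe
  have hAeA : (Ae : EuclideanSpace ℝ (Fin a) →L[ℝ] EuclideanSpace ℝ (Fin a)) = fstBlock (fderiv ℝ φ 0) :=
    ContinuousLinearMap.coe_toContinuousLinearEquivOfDetNeZero _ _
  obtain ⟨σ, W, hWo, h0W, hσ0, hσs, hγs, -, -, hσright, -, hγ0, hgraph⟩ :=
    exists_graph_fst_apply hO h0O hs h0 Ae hAeA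
  -- the target isotopy `Ψ`, straightening the graph
  obtain ⟨Ψ, hΨsupp, hΨfix, hΨfst, hΨ1, hΨdet, hΨDfst⟩ :=
    exists_ambientIsotopy_straighten hWo h0W hγs (by simpa [hσ0] using hγ0) hρ
  -- the straightened germ `φ' = Ψ₁ ∘ φ`
  set φ' := fun x : EuclideanSpace ℝ (Fin a) × EuclideanSpace ℝ (Fin b) => Ψ.toFun 1 (φ x) with hφ'
  have hΨs : ∀ t, ContDiff ℝ ∞ (Ψ.toFun t) := fun t => Ψ.contDiff_toFun t
  have hφ's : ContDiffOn ℝ ∞ φ' O := (hΨs 1).comp_contDiffOn hs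
  have hφ'0 : φ' 0 = 0 := by simp only [hφ', h0, hΨfix]
  have hDΨ1 : HasFDerivAt (Ψ.toFun 1) (fderiv ℝ (Ψ.toFun 1) 0) (φ 0) := by
    rw [h0]
    exact ((hΨs 1).differentiable (by simp) 0).hasFDerivAt
  have hDφ' : HasFDerivAt φ' ((fderiv ℝ (Ψ.toFun 1) 0).comp L) 0 := hDΨ1.comp 0 hLd
  have hφ'det : 0 < (fderiv ℝ φ' 0).det := by
    rw [hDφ'.fderiv]
    change 0 < LinearMap.det ((((fderiv ℝ (Ψ.toFun 1) 0).comp L : (EuclideanSpace ℝ (Fin a) × EuclideanSpace ℝ (Fin b)) →L[ℝ] (EuclideanSpace ℝ (Fin a) × EuclideanSpace ℝ (Fin b)))) :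
      (EuclideanSpace ℝ (Fin a) × EuclideanSpace ℝ (Fin b)) →ₗ[ℝ] (EuclideanSpace ℝ (Fin a) × EuclideanSpace ℝ (Fin b)))
    rw [ContinuousLinearMap.toLinearMap_comp, LinearMap.det_comp]
    exact mul_pos hΨdet hdet
  have hφ'A : 0 < (fstBlock (fderiv ℝ φ' 0)).det := by
    have heq : fstBlock (fderiv ℝ φ' 0) = fstBlock L := by
      ext1 u
      rw [hDφ'.fderiv, fstBlock_apply, fstBlock_apply, ContinuousLinearMap.comp_apply, hΨDfst]
    rw [heq]
    exact hA
  -- `φ'` maps `Rᵃ × 0` into itself near `0`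
  have h00 : ((0 : EuclideanSpace ℝ (Fin a)), (0 : EuclideanSpace ℝ (Fin b))) =
      (0 : EuclideanSpace ℝ (Fin a) × EuclideanSpace ℝ (Fin b)) := rfl
  have hφt : Tendsto (fun u : EuclideanSpace ℝ (Fin a) => φ (u, 0)) (𝓝 0) (𝓝 0) := by
    have h1 : Tendsto (fun u : EuclideanSpace ℝ (Fin a) => ((u, (0 : EuclideanSpace ℝ (Fin b))) : EuclideanSpace ℝ (Fin a) × EuclideanSpace ℝ (Fin b))) (𝓝 0) (𝓝 0) := by
      rw [← h00, nhds_prod_eq]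
      exact tendsto_id.prodMk tendsto_const_nhds
    have h2 : Tendsto φ (𝓝 0) (𝓝 (φ 0)) := hsat.continuousAt.tendsto
    rw [h0] at h2
    exact h2.comp h1
  have hφ'Sa : ∀ᶠ u in 𝓝 (0 : EuclideanSpace ℝ (Fin a)), (φ' (u, 0)).2 = 0 := by
    filter_upwards [hφt.eventually hΨ1, hgraph] with u hu hg
    change (Ψ.toFun 1 (φ (u, 0))).2 = 0
    rw [hu]
    have := congrArg Prod.snd hg
    exact sub_eq_zero.2 this
  -- `φ' (σ w, 0) = (w, 0)` near `0`
  have hσt : Tendsto σ (𝓝 0) (𝓝 0) := by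
    have := (hσs.continuousOn.continuousAt (hWo.mem_nhds h0W)).tendsto
    rwa [hσ0] at this
  have hφ'σ : ∀ᶠ w in 𝓝 (0 : EuclideanSpace ℝ (Fin a)), φ' (σ w, 0) = (w, 0) := by
    have h1 : ∀ᶠ w in 𝓝 (0 : EuclideanSpace ℝ (Fin a)), (φ (σ w, 0)).1 = w :=
      eventually_of_mem (hWo.mem_nhds h0W) hσright
    filter_upwards [h1, hσt.eventually hφ'Sa] with w hw1 hw2
    refine Prod.ext ?_ hw2
    change (Ψ.toFun 1 (φ (σ w, 0))).1 = w
    rw [hΨfst, hw1]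
  -- the source isotopy `Φ`
  obtain ⟨Φ, hΦsupp, hΦfix, hΦS, hΦinv⟩ :=
    exists_ambientIsotopy_localInverse_of_contDiffOn hO h0O hφ's hφ'0 hφ'det hφ'A hφ'Sa hσt
      hφ'σ hρ
  exact ⟨Ψ, Φ, hΨsupp, hΨfix, hΨfst, hΦsupp, hΦfix, hΦS, hΦinv⟩

/-- **Condition (III) for the pair**: with `Ψ`, `Φ` as in `exists_ambientIsotopy_pair` (only the
preservation properties and the injectivity of `Φ₁` are used), if hypothesis 2) of Thm. 5.6
holds for `φ` on the points `(u, 0)` in question — `(φ (u, 0)).1 = 0 → u = 0` — then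
`Ψ₁ (φ (Φ₁ (u, 0))) ∈ Rᵇ` forces `u = 0`. [cite: MilnorHCobordism1965, Thm. 5.6 (III) (PDF p. 32)] -/
theorem fst_eq_zero_of_pair
    {φ : EuclideanSpace ℝ (Fin a) × EuclideanSpace ℝ (Fin b) → EuclideanSpace ℝ (Fin a) × EuclideanSpace ℝ (Fin b)}
    (Ψ Φ : AmbientIsotopy 𝓘(ℝ, EuclideanSpace ℝ (Fin a) × EuclideanSpace ℝ (Fin b)) (EuclideanSpace ℝ (Fin a) × EuclideanSpace ℝ (Fin b)))
    (hΨfst : ∀ t y, (Ψ.toFun t y).1 = y.1) (hΦfix : ∀ t, Φ.toFun t 0 = 0)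
    (hΦS : ∀ t x, x.2 = 0 → (Φ.toFun t x).2 = 0) {t : ℝ} {u : EuclideanSpace ℝ (Fin a)}
    (htr : (φ (Φ.toFun t (u, 0))).1 = 0 → (Φ.toFun t (u, 0)).1 = 0)
    (hu : (Ψ.toFun t (φ (Φ.toFun t (u, 0)))).1 = 0) : u = 0 := by
  rw [hΨfst] at hu
  have h2 : (Φ.toFun t (u, 0)).2 = 0 := hΦS t (u, 0) rfl
  have hz : (Φ.toFun t (u, 0)).1 = 0 := htr hu
  have hΦ0 : Φ.toFun t (u, 0) = 0 := by
    rw [show Φ.toFun t (u, 0) = ((Φ.toFun t (u, 0)).1, (Φ.toFun t (u, 0)).2) from rfl, hz, h2]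
    rfl
  have := (Φ.bijective t).1 (hΦ0.trans (hΦfix t).symm)
  have := congrArg Prod.fst this
  simpa using this

end Pair

end Literature.Topology.FourManifolds
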